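import Summits.QuantumAdvantage.QuantumAdvantage.Theorems.OddPrimeWalkColumnResolutionRung

/-!
# OddPrimeWalk — the LOG-MULTIPLICITY and MULTI-COUNTER rungs at `p = 5` (items stmt-QuantumAdvantage-24270
# `LogMultiplicityRungFive` and stmt-QuantumAdvantage-24257 `MultiCounterRungFive`), corollaries of the column-resolution rung

Route OddPrimeWalk (planner qa-qnc0-p2 g32, ROUND-32 §3bis / PROOF-MC §4, §8–§9); prover qn-prover-3 g20.

* `oddPrimeWalk_logMultiplicityRungFive` (24270, route-file signature verbatim): every cut an arbitrary function of the class
  counters mod 5 of a colouring all of whose classes have `≥ C·log₂ n` members ⇒ value `≤ θ` for every `θ > 2/3`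
  (`oddPrimeWalk_columnResolutionRungFive` with `S = ∅`).
* `oddPrimeWalk_multiCounterRungFive` (24257, route-file signature verbatim): `K` classes of arbitrary sizes, one `θ < 1` for all
  `K` (`θ = 5/6`): pin the union `S` of the classes of size `< C·log₂ n` (`|S| ≤ K·C·log₂ n < n` for `n ≥ 2^{CK+1}`,
  `mul_lt_two_pow`) and apply the column-resolution rung to the remaining (large) classes.
WHAT THIS IS NOT: (R₁) / item 24200 untouched; separation NOT moved.
-/

noncomputable section

namespace Summit.QuantumAdvantage.AdviceFreeQNC0

open Finset

namespace ColRes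

/-- `A·(A+1) < 2^{A+1}`. -/
theorem mul_succ_lt_two_pow (A : ℕ) : A * (A + 1) < 2 ^ (A + 1) := by
  induction A with
  | zero => norm_num
  | succ A ih =>
    have h : A < 2 ^ A := Nat.lt_two_pow_self
    have h2 : 2 ^ (A + 1) = 2 * 2 ^ A := by rw [pow_succ]; ring
    calc (A + 1) * (A + 1 + 1) = A * (A + 1) + 2 * (A + 1) := by ring
      _ < 2 ^ (A + 1) + 2 * 2 ^ A := by omega
      _ = 2 ^ (A + 1 + 1) := by rw [pow_succ, pow_succ, pow_succ]; ring

/-- `A·t < 2^t` once `t ≥ A + 1`. -/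
theorem mul_lt_two_pow (A : ℕ) : ∀ t : ℕ, A + 1 ≤ t → A * t < 2 ^ t := by
  intro t ht
  induction t with
  | zero => omega
  | succ t ih =>
    by_cases h : A + 1 ≤ t
    · have h1 := ih h
      have h2 : A < 2 ^ t := lt_of_le_of_lt (by omega : A ≤ t) Nat.lt_two_pow_self
      calc A * (t + 1) = A * t + A := by ring
        _ < 2 ^ t + 2 ^ t := by omega
        _ = 2 ^ (t + 1) := by rw [pow_succ]; ring
    · have ht' : t = A := by omega
      subst ht'
      exact mul_succ_lt_two_pow t

/-- `A·log₂ n < n` for `n ≥ 2^{A+1}`. -/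
theorem mul_log_lt (A n : ℕ) (hn : 2 ^ (A + 1) ≤ n) : A * Nat.log 2 n < n := by
  have ht : A + 1 ≤ Nat.log 2 n := Nat.le_log_of_pow_le (by norm_num) hn
  have hn0 : n ≠ 0 := by have := Nat.one_le_two_pow (n := A + 1); omega
  exact (mul_lt_two_pow A _ ht).trans_le (Nat.pow_log_le_self 2 hn0)

end ColRes

end Summit.QuantumAdvantage.AdviceFreeQNC0

namespace Summit.QuantumAdvantage.QuantumAdvantage.Theorems

open Finset Summit.QuantumAdvantage.AdviceFreeQNC0

set_option linter.dupNamespace false in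
/-- **LOG-MULTIPLICITY RUNG at `p = 5`** (item stmt-QuantumAdvantage-24270 `LogMultiplicityRungFive`, route OddPrimeWalk; the route
file's signature verbatim): the column-resolution rung with nothing pinned. -/
theorem oddPrimeWalk_logMultiplicityRungFive :
    ∀ θ : ℝ, 2 / 3 < θ → ∃ C n₀ : ℕ, ∀ n ≥ n₀, ∀ c K : ℕ, ∀ κ : Fin n → Fin K, (∀ i : Fin n, C * Nat.log 2 n ≤ (Finset.univ.filter fun i' : Fin n => κ i' = κ i).card) → ∀ T : Fin (n + 1) → (Fin K → ZMod 5) → Bool, ∀ y : Fin (n + 1) → (Fin n → Bool) → Bool, (∀ g u, y g u = T g (fun k => (((Finset.univ.filter fun i : Fin n => κ i = k ∧ u i = true).card : ℕ) : ZMod 5))) → ((Finset.univ.filter fun u : Fin n → Bool => Summit.QuantumAdvantage.AdviceFreeQNC0.ringWinU c y u = true).card : ℝ) ≤ θ * (2 : ℝ) ^ n := by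
  intro θ hθ
  obtain ⟨C, n₀, h⟩ := oddPrimeWalk_columnResolutionRungFive θ hθ
  refine ⟨C, max n₀ 1, fun n hn c K κ hL T y hy => ?_⟩
  have hn1 : 1 ≤ n := le_of_max_le_right hn
  refine h n (le_of_max_le_left hn) c K ∅ ⟨⟨0, by omega⟩, by simp⟩ κ ?_ y ?_
  · intro i _
    have e : (univ.filter fun i' : Fin n => i' ∉ (∅ : Finset (Fin n)) ∧ κ i' = κ i) = univ.filter fun i' : Fin n => κ i' = κ i := by
      ext i'; simp
    rw [e]; exact hL i
  · intro g u u' _ hcnt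
    rw [hy g u, hy g u']
    congr 1
    funext k
    have e : ∀ w : Fin n → Bool, (univ.filter fun i : Fin n => κ i = k ∧ w i = true) =
        univ.filter fun i : Fin n => i ∉ (∅ : Finset (Fin n)) ∧ κ i = k ∧ w i = true := by
      intro w; ext i; simp
    rw [e u, e u']
    exact hcnt k

set_option linter.dupNamespace false in
/-- **MULTI-COUNTER RUNG at `p = 5`** (item stmt-QuantumAdvantage-24257 `MultiCounterRungFive`, route OddPrimeWalk; the route
file's signature verbatim, `θ = 5/6`): pin the small classes, resolve the large ones. -/
theorem oddPrimeWalk_multiCounterRungFive :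
    ∃ θ : ℝ, θ < 1 ∧ ∀ K : ℕ, ∃ n₀ : ℕ, ∀ n ≥ n₀, ∀ c : ℕ, ∀ κ : Fin n → Fin K, ∀ T : Fin (n + 1) → (Fin K → ZMod 5) → Bool, ∀ y : Fin (n + 1) → (Fin n → Bool) → Bool, (∀ g u, y g u = T g (fun k => (((Finset.univ.filter fun i : Fin n => κ i = k ∧ u i = true).card : ℕ) : ZMod 5))) → ((Finset.univ.filter fun u : Fin n → Bool => Summit.QuantumAdvantage.AdviceFreeQNC0.ringWinU c y u = true).card : ℝ) ≤ θ * (2 : ℝ) ^ n := by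
  obtain ⟨C, n₀, h⟩ := oddPrimeWalk_columnResolutionRungFive (5 / 6) (by norm_num)
  refine ⟨5 / 6, by norm_num, fun K => ⟨max n₀ (2 ^ (C * K + 1)), fun n hn c κ T y hy => ?_⟩⟩
  classical
  have hn₀ : n₀ ≤ n := le_of_max_le_left hn
  have hnA : 2 ^ (C * K + 1) ≤ n := le_of_max_le_right hn
  set L := C * Nat.log 2 n with hLdef
  -- the small classes
  set S : Finset (Fin n) := univ.filter fun i : Fin n => (univ.filter fun i' : Fin n => κ i' = κ i).card < L with hSdef
  have hSmem : ∀ i : Fin n, i ∈ S ↔ (univ.filter fun i' : Fin n => κ i' = κ i).card < L := fun i => by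
    rw [hSdef, mem_filter]; simp
  -- same class ⇒ same membership in `S`
  have hSclass : ∀ i i' : Fin n, κ i' = κ i → (i' ∈ S ↔ i ∈ S) := by
    intro i i' hk; rw [hSmem, hSmem, hk]
  -- `|S| ≤ K·L < n`
  have hScard : S.card ≤ K * L := by
    rw [card_eq_sum_card_fiberwise (f := κ) (s := S) (t := (univ : Finset (Fin K))) (fun _ _ => Finset.mem_coe.mpr (mem_univ _))]
    have hk : ∀ k ∈ (univ : Finset (Fin K)), (S.filter fun i => κ i = k).card ≤ L := by
      intro k _
      by_cases hsm : ∃ i ∈ S, κ i = k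
      · obtain ⟨i, hi, hik⟩ := hsm
        have hlt := (hSmem i).mp hi
        refine le_trans (card_le_card ?_) hlt.le
        intro i' hi'
        rw [mem_filter] at hi' ⊢
        exact ⟨mem_univ _, by rw [hi'.2, hik]⟩
      · rw [Finset.card_eq_zero.mpr]
        · exact Nat.zero_le _
        · rw [Finset.filter_eq_empty_iff]; exact fun i hi hik => hsm ⟨i, hi, hik⟩
    calc ∑ k ∈ (univ : Finset (Fin K)), (S.filter fun i => κ i = k).card ≤ ∑ _k ∈ (univ : Finset (Fin K)), L :=
          sum_le_sum hk
      _ = K * L := by rw [sum_const, card_univ, Fintype.card_fin, smul_eq_mul]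
  have hlt : K * L < n := by
    rw [hLdef, ← mul_assoc, mul_comm K C]
    exact ColRes.mul_log_lt (C * K) n hnA
  have hfree : ∃ i : Fin n, i ∉ S := by
    by_contra hno
    push Not at hno
    have : (univ : Finset (Fin n)) ⊆ S := fun i _ => hno i
    have := card_le_card this
    rw [card_univ, Fintype.card_fin] at this
    omega
  refine h n hn₀ c K S hfree κ ?_ y ?_
  · -- large classes are entirely free and large
    intro i hi
    have hge : L ≤ (univ.filter fun i' : Fin n => κ i' = κ i).card := by
      have := (hSmem i).not.mp hi; omega
    refine hge.trans (le_of_eq ?_)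
    congr 1
    ext i'
    simp only [mem_filter, mem_univ, true_and]
    constructor
    · intro hk; exact ⟨fun hi' => hi ((hSclass i i' hk).mp hi'), hk⟩
    · exact fun h => h.2
  · -- the strategy is determined by `u|_S` and the large-class counters
    intro g u u' hSu hcnt
    rw [hy g u, hy g u']
    congr 1
    funext k
    by_cases hbig : ∃ i : Fin n, i ∉ S ∧ κ i = k
    · obtain ⟨i₀, hi₀, hk₀⟩ := hbig
      have e : ∀ w : Fin n → Bool, (univ.filter fun i : Fin n => κ i = k ∧ w i = true) =
          univ.filter fun i : Fin n => i ∉ S ∧ κ i = k ∧ w i = true := by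
        intro w; ext i
        simp only [mem_filter, mem_univ, true_and]
        constructor
        · rintro ⟨hk, hw⟩
          exact ⟨fun hi => hi₀ ((hSclass i₀ i (by rw [hk, hk₀])).mp hi), hk, hw⟩
        · rintro ⟨_, hk, hw⟩; exact ⟨hk, hw⟩
      rw [e u, e u']
      exact hcnt k
    · -- a small (or empty) class lies inside `S`, where `u = u'`
      push Not at hbig
      congr 2
      ext i
      simp only [mem_filter, mem_univ, true_and]
      constructor
      · rintro ⟨hk, hw⟩
        have hi : i ∈ S := by by_contra hi; exact hbig i hi hk
        exact ⟨hk, by rw [← hSu i hi]; exact hw⟩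
      · rintro ⟨hk, hw⟩
        have hi : i ∈ S := by by_contra hi; exact hbig i hi hk
        exact ⟨hk, by rw [hSu i hi]; exact hw⟩

end Summit.QuantumAdvantage.QuantumAdvantage.Theorems

end
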